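import Literature.AlgebraicGeometry.HodgeTheory.AlgebraicClassesExteriorProduct
import Literature.AlgebraicGeometry.HodgeTheory.CorrespondenceComposition
import Literature.AlgebraicGeometry.Limits.SubalgebraDiagram
import HarnessLib

/-!
# Codimension of points of `X ⊗ (Y ⊗ Z)` relative to the two partial projections `p₁₂`, `p₂₃`

Family `hodge`, layer `Literature/AlgebraicGeometry/HodgeTheory`. Companion of
`AlgebraicClassesExteriorProduct` (`le_coheight_of_fst_mem_of_snd_mem`: codimensions add on
`V ⊗ V'`) for the fibre-product shape met when composing correspondences
(`CorrespondenceComposition`, Fulton Def. 16.1.1 `β ∘ α = p₁₃*(p₁₂^*α · p₂₃^*β)`): on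
`X ⊗ (Y ⊗ Z) = (X ⊗ Y) ×_Y (Y ⊗ Z)`, with `p₁₂ = X ◁ pr_Y`, `p₂₃ = pr_{Y ⊗ Z}`, `p₂ = p₂₃ ≫ pr_Y`,

* `coheight_p12_add_coheight_p23_le` — **codimension is superadditive over the middle factor**:
  `codim p₁₂(t) + codim p₂₃(t) ≤ codim t + codim p₂(t)` for every point `t` (R. Hartshorne,
  *Algebraic Geometry*, III Prop. 9.5, the dimension formula for the flat projections `p₂₃` and
  `pr_Y : X ⊗ Y → Y`, `codim t = codim p₂₃(t) + codim_{F} t`, `codim p₁₂(t) = codim p₂(t) + codim_{G} p₁₂(t)`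
  on the fibres `F = p₂₃⁻¹(p₂₃ t) = X_{κ(p₂₃ t)}`, `G = pr_Y⁻¹(p₂ t) = X_{κ(p₂ t)}`, and `F → G` is the
  flat base change of `Spec κ(p₂₃ t) → Spec κ(p₂ t)`, along which codimension does not drop);
* `le_coheight_of_p12_mem_of_p23_mem` — hence, for `S ⊆ X ⊗ Y` of codimension `≥ r` and
  `S' ⊆ Y ⊗ Z` of codimension `≥ s`, a point `t` with `p₁₂ t ∈ S`, `p₂₃ t ∈ S'` and `codim p₂ t ≤ e`
  has `codim t ≥ r + s - e` (stated additively).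

Everything is proved (Mathlib's `isPullback_fiberToSpecResidueField_of_isPullback` for the
cartesian square `p₁₂, p₂₃` over `pr_Y`, the tree's `isPullback_whiskerLeft_left`).

## References

* [Hartshorne1977] R. Hartshorne, Algebraic Geometry, Springer 1977, III Prop. 9.5 (dimension of
  the fibres of a flat morphism), II Ex. 3.22.
* [Fulton1998] W. Fulton, Intersection Theory, 2nd ed. 1998, §16.1 Def. 16.1.1 (composition of
  correspondences), §8.2 (expected dimension of `p₁₂⁻¹ α ∩ p₂₃⁻¹ β`).
-/

noncomputable section

open CategoryTheory AlgebraicGeometry MonoidalCategory CartesianMonoidalCategory Limits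

namespace Literature.AlgebraicGeometry.HodgeTheory

section HodgeTheory

variable {l m n : ℕ} {X Y Z : Motives.SchemeOver ℂ}

/-- The dimension formula for a flat morphism of locally Noetherian schemes, for ANY point `y` of
the scheme-theoretic fibre over `z` lying over `x` (not only `f.asFiber x`):
`codim x = codim z + codim_{X_z} y`. [cite: Hartshorne1977, III Prop. 9.5] -/
theorem coheight_eq_coheight_add_coheight_of_fiberι_eq {X' Y' : Scheme} (f : X' ⟶ Y') [Flat f]
    [IsLocallyNoetherian X'] [IsLocallyNoetherian Y'] {z : Y'} (y : ↥(f.fiber z)) {x : X'}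
    (hy : (f.fiberι z).base y = x) :
    Order.coheight x = Order.coheight z + Order.coheight y := by
  have hz : f.base x = z := by
    have hmem : x ∈ Set.range (f.fiberι z).base := ⟨y, hy⟩
    rw [Scheme.Hom.range_fiberι] at hmem
    simpa using hmem
  subst hz
  have hy' : y = f.asFiber x :=
    (f.fiberι (f.base x)).isEmbedding.injective (by rw [hy, Scheme.Hom.fiberι_asFiber])
  subst hy'
  exact Motives.coheight_eq_coheight_add_coheight_asFiber f x

/-- **Codimension is superadditive over the middle factor of `X ⊗ (Y ⊗ Z)`**: for `X`, `Y`, `Z`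
smooth projective over `ℂ` and every point `t` of `X ⊗ (Y ⊗ Z)`,
`codim p₁₂(t) + codim p₂₃(t) ≤ codim t + codim p₂(t)` (`p₁₂ = X ◁ pr_Y`, `p₂₃ = pr_{Y ⊗ Z}`,
`p₂ = p₂₃ ≫ pr_Y`). Proof: the square `(p₁₂, p₂₃)` over `pr_Y : X ⊗ Y → Y ← Y ⊗ Z : pr_Y` is cartesian
(`isPullback_whiskerLeft_left`), so the fibre `F` of `p₂₃` through `t` maps to the fibre `G` of
`pr_Y : X ⊗ Y → Y` through `p₁₂ t` by a base change of `Spec κ(p₂₃ t) → Spec κ(p₂ t)`, which is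
flat; codimension does not drop along it (`coheight_base_le_of_flat`), and the dimension formula
(Hartshorne III Prop. 9.5, `Motives.coheight_eq_coheight_add_coheight_asFiber`) for the flat
projections `p₂₃` and `pr_Y` converts this into the stated inequality.
[cite: Hartshorne1977, III Prop. 9.5] [cite: Fulton1998, §16.1 Def. 16.1.1] -/
theorem coheight_p12_add_coheight_p23_le (hX : Motives.IsSmoothProjective l X)
    (hY : Motives.IsSmoothProjective m Y) (hZ : Motives.IsSmoothProjective n Z)
    (t : ↥(X ⊗ (Y ⊗ Z)).left) :
    Order.coheight ((X ◁ fst Y Z).left.base t) + Order.coheight ((snd X (Y ⊗ Z)).left.base t) ≤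
      Order.coheight t +
        Order.coheight ((fst Y Z).left.base ((snd X (Y ⊗ Z)).left.base t)) := by
  have hYZ := Motives.IsSmoothProjective.tensor_holds hY hZ
  have hXY := Motives.IsSmoothProjective.tensor_holds hX hY
  haveI := Motives.IsSmoothProjective.isLocallyNoetherian_holds hY
  haveI := Motives.IsSmoothProjective.isLocallyNoetherian_holds hYZ
  haveI := Motives.IsSmoothProjective.isLocallyNoetherian_holds hXY
  haveI := Motives.IsSmoothProjective.isLocallyNoetherian_holds
    (Motives.IsSmoothProjective.tensor_holds hX hYZ)
  haveI : Flat (snd X (Y ⊗ Z)).left := snd_left_flat X (Y ⊗ Z)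
  haveI : Flat (snd X Y).left := snd_left_flat X Y
  haveI : LocallyOfFiniteType X.hom := locallyOfFiniteType_of_isSmoothProjective hX
  haveI : LocallyOfFiniteType (snd X (Y ⊗ Z)).left := by
    change LocallyOfFiniteType (pullback.snd X.hom (Y ⊗ Z).hom)
    exact MorphismProperty.pullback_snd _ _ inferInstance
  haveI : LocallyOfFiniteType (snd X Y).left := by
    change LocallyOfFiniteType (pullback.snd X.hom Y.hom)
    exact MorphismProperty.pullback_snd _ _ inferInstance
  -- the cartesian square `p₁₂, p₂₃` over `pr_Y`
  have Q : IsPullback (X ◁ fst Y Z).left (snd X (Y ⊗ Z)).left (snd X Y).left (fst Y Z).left :=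
    Limits.SubalgApprox.isPullback_whiskerLeft_left X (fst Y Z)
  -- the flat comparison `φ : F → G` of the fibres through `t` and through `p₁₂ t`
  haveI : IsLocallyNoetherian ((snd X (Y ⊗ Z)).left.fiber ((snd X (Y ⊗ Z)).left.base t)) :=
    Motives.isLocallyNoetherian_fiber (snd X (Y ⊗ Z)).left _
  haveI : IsLocallyNoetherian
      ((snd X Y).left.fiber ((fst Y Z).left.base ((snd X (Y ⊗ Z)).left.base t))) :=
    Motives.isLocallyNoetherian_fiber (snd X Y).left _
  obtain ⟨φ, H, hφι⟩ : ∃ φ : (snd X (Y ⊗ Z)).left.fiber ((snd X (Y ⊗ Z)).left.base t) ⟶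
      (snd X Y).left.fiber ((fst Y Z).left.base ((snd X (Y ⊗ Z)).left.base t)),
      IsPullback φ ((snd X (Y ⊗ Z)).left.fiberToSpecResidueField _)
        ((snd X Y).left.fiberToSpecResidueField _)
        (Spec.map ((fst Y Z).left.residueFieldMap _)) ∧
      φ ≫ (snd X Y).left.fiberι _ = (snd X (Y ⊗ Z)).left.fiberι _ ≫ (X ◁ fst Y Z).left :=
    ⟨_, isPullback_fiberToSpecResidueField_of_isPullback Q _, pullback.lift_fst _ _ _⟩
  -- a morphism to the spectrum of a field is flat, hence so is its base change `φ`
  haveI : Flat (Spec.map ((fst Y Z).left.residueFieldMap ((snd X (Y ⊗ Z)).left.base t))) :=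
    inferInstance
  haveI : Flat φ := MorphismProperty.of_isPullback H.flip ‹_›
  -- the point of `F` through `t` and its image in `G`, which lies over `p₁₂ t`
  have hφx : ((snd X Y).left.fiberι _).base (φ.base ((snd X (Y ⊗ Z)).left.asFiber t)) =
      (X ◁ fst Y Z).left.base t := by
    have h1 : (φ ≫ (snd X Y).left.fiberι _).base ((snd X (Y ⊗ Z)).left.asFiber t) =
        ((snd X (Y ⊗ Z)).left.fiberι _ ≫ (X ◁ fst Y Z).left).base
          ((snd X (Y ⊗ Z)).left.asFiber t) := by
      rw [hφι]
    rw [Scheme.Hom.comp_base, Scheme.Hom.comp_base, TopCat.comp_app, TopCat.comp_app,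
      Scheme.Hom.fiberι_asFiber] at h1
    exact h1
  -- dimension formulas for the flat projections `p₂₃` and `pr_Y : X ⊗ Y → Y`
  have h₁ : Order.coheight t = Order.coheight ((snd X (Y ⊗ Z)).left.base t) +
      Order.coheight ((snd X (Y ⊗ Z)).left.asFiber t) :=
    Motives.coheight_eq_coheight_add_coheight_asFiber (snd X (Y ⊗ Z)).left t
  have h₂ : Order.coheight ((X ◁ fst Y Z).left.base t) =
      Order.coheight ((fst Y Z).left.base ((snd X (Y ⊗ Z)).left.base t)) +
        Order.coheight (φ.base ((snd X (Y ⊗ Z)).left.asFiber t)) :=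
    coheight_eq_coheight_add_coheight_of_fiberι_eq (snd X Y).left _ hφx
  have h₃ : Order.coheight (φ.base ((snd X (Y ⊗ Z)).left.asFiber t)) ≤
      Order.coheight ((snd X (Y ⊗ Z)).left.asFiber t) :=
    coheight_base_le_of_flat φ _
  rw [h₂, h₁]
  calc Order.coheight ((fst Y Z).left.base ((snd X (Y ⊗ Z)).left.base t)) +
        Order.coheight (φ.base ((snd X (Y ⊗ Z)).left.asFiber t)) +
        Order.coheight ((snd X (Y ⊗ Z)).left.base t)
      ≤ Order.coheight ((fst Y Z).left.base ((snd X (Y ⊗ Z)).left.base t)) +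
        Order.coheight ((snd X (Y ⊗ Z)).left.asFiber t) +
        Order.coheight ((snd X (Y ⊗ Z)).left.base t) := by
        gcongr
    _ = Order.coheight ((snd X (Y ⊗ Z)).left.base t) +
        Order.coheight ((snd X (Y ⊗ Z)).left.asFiber t) +
        Order.coheight ((fst Y Z).left.base ((snd X (Y ⊗ Z)).left.base t)) := by
        abel

/-- **Expected codimension of `p₁₂⁻¹ S ∩ p₂₃⁻¹ S'`, pointwise**: on `X ⊗ (Y ⊗ Z)` (all smooth
projective over `ℂ`), if every point of `S ⊆ X ⊗ Y` has codimension `≥ r`, every point of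
`S' ⊆ Y ⊗ Z` has codimension `≥ s`, and `t` is a point with `p₁₂ t ∈ S`, `p₂₃ t ∈ S'` whose image
`p₂ t ∈ Y` has codimension `≤ e`, then `r + s ≤ codim t + e`. [cite: Hartshorne1977, III Prop. 9.5]
[cite: Fulton1998, §16.1 Def. 16.1.1] -/
theorem le_coheight_of_p12_mem_of_p23_mem (hX : Motives.IsSmoothProjective l X)
    (hY : Motives.IsSmoothProjective m Y) (hZ : Motives.IsSmoothProjective n Z)
    {S : Set ↥(X ⊗ Y).left} {S' : Set ↥(Y ⊗ Z).left} {r s : ℕ} {e : ℕ∞}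
    (hS : ∀ u ∈ S, (r : ℕ∞) ≤ Order.coheight u) (hS' : ∀ u ∈ S', (s : ℕ∞) ≤ Order.coheight u)
    {t : ↥(X ⊗ (Y ⊗ Z)).left} (h₁ : (X ◁ fst Y Z).left.base t ∈ S)
    (h₂ : (snd X (Y ⊗ Z)).left.base t ∈ S')
    (he : Order.coheight ((fst Y Z).left.base ((snd X (Y ⊗ Z)).left.base t)) ≤ e) :
    ((r + s : ℕ) : ℕ∞) ≤ Order.coheight t + e := by
  have h := coheight_p12_add_coheight_p23_le hX hY hZ t
  calc ((r + s : ℕ) : ℕ∞) = (r : ℕ∞) + (s : ℕ∞) := by push_cast; rfl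
    _ ≤ Order.coheight ((X ◁ fst Y Z).left.base t) + Order.coheight ((snd X (Y ⊗ Z)).left.base t) :=
        add_le_add (hS _ h₁) (hS' _ h₂)
    _ ≤ Order.coheight t + Order.coheight ((fst Y Z).left.base ((snd X (Y ⊗ Z)).left.base t)) := h
    _ ≤ Order.coheight t + e := by gcongr

end HodgeTheory

end Literature.AlgebraicGeometry.HodgeTheory

end
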